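import Summits.BirchSwinnertonDyer.BirchSwinnertonDyer.Theses.AlignedTransportAtTwo
import Summits.BirchSwinnertonDyer.BirchSwinnertonDyer.Theorems.Rank1ResidualX1Defs
import Literature.NumberTheory.EllipticCurves.BSDRootNumberSmallConductorAssemblyProofs
import Literature.NumberTheory.EllipticCurves.LeadingTerm
import Summits.BirchSwinnertonDyer.BirchSwinnertonDyer.Theorems.AlignedTransportAtTwoBSDOfMainConjectureRankOneAtTwoOrderTransfer
import Literature.NumberTheory.EllipticCurves.KatoRankBoundProofs
import Literature.NumberTheory.EllipticCurves.IwasawaSelmerModuleFiniteProofs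
import HarnessLib

/-!
# Route `AlignedTransportAtTwo`, crux C3′ `BSDOfMainConjectureRankOneAtTwo` (stmt-BirchSwinnertonDyer-23008), line `birth`,
# stub L — the NORMALISATION-FREE closure algebra: a `p`-adic leading-term law and a `p`-adic/archimedean comparison law
# written in the SAME currency give `BSD(E,p)`; and the generator plumbing `[T¹]f_E = unit · ϖ · [T¹]L_p`

HONEST FRAMING (cell `bsd-f1-sign2`, lead seat `bsd-line-att-p1` g2; BSD is NOT proved by any of this; THEOREMS ONLY, nothing
asserted, no definition). Stub L of line `birth` (`AlgebraicSimpleZeroAtTwo → BSDOfMainConjectureRankOneAtTwo`) decomposes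
(lead addendum, `Cruxes/BSDOfMainConjectureRankOneAtTwo/Lines/birth.md`) as L0 (GZK + the `Σ²` height receptacle, PRINT, in
tree) + L1 (Schneider–Perrin-Riou / BMS Thm 1.7 leading term AT `p = 2`, OPEN at `2`, to be typed) + L2 (Perrin-Riou's rank-one
comparison AT `p = 2`: the `2`-adic and the archimedean BSD quotients are the same rational number, OPEN at `2`, to be typed) +
L3 (closure algebra). L1 and L2 carry powers of `2` nobody in the tree can certify today (height currency SW = `−4·`MST in rank
one, `ε₂ = (1 − α⁻¹)²` with `v₂ ∈ {2,4}`, `log₂ 5`); but those constants CANCEL between L1 and L2. This file proves L3 in a form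
that does not depend on them: the two laws are taken with ABSTRACT `p`-adic quantities `A` (the «analytic» product, e.g.
`ϖ·[T¹]L_p(f,α)·log_p γ`) and `B ≠ 0` (the «regulator» product, e.g. `ε_p·Reg_p(Dh)`), the SAME `A, B` in both — then
`#E(ℚ)_tors²` and `∏ c_v` cancel too, so NO Tamagawa-at-`2` or torsion input is needed, and `BSDp W p` follows with the witness
`q · #E(ℚ)_tors² / ∏ c_v`. Any prime `p`; any curve with `r_an ≤ 1` (GZK supplies rank and finiteness).

* §1 `exists_unit_coeff_one_eq_of_span_eq` — two generators of the same principal ideal of `Λ = ℤ_p⟦T⟧`, one with a zero at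
  `T = 0`: their `T¹`-coefficients differ by a unit of `ℤ_p`; `coeff_one_eq_ratCast_mul_of_iwasawaToPowerSeries_eq` — from the
  main-conjecture identity `ι g = ϖ · L` read off `[T¹]g = ϖ · [T¹]L` in `ℚ_p` (the plumbing that lets L1, stated for ANY
  characteristic generator `f_E`, be applied to `ϖ · L_p(f_E, α)`).
* §2 `padicValRat_eq_of_ratCast_eq_unit_mul_natCast` — `(q : ℚ_p) = u · n`, `u ∈ ℤ_pˣ`, `n ≥ 1` ⟹ `ord_p q = ord_p n`.
* §3 `bsdp_of_leadingTerm_of_comparison` — L3: GZK + a leading-term law `A · tors² = u · #Ш[p^∞] · B · Tam` + a comparison law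
  `q · B = A ∧ q · Ω · Reg_∞ = L^{(r)}(E,1)/r!` ⟹ `BSDp W p`.
* §4 `bsdOfMainConjectureRankOneAtTwo_of_consistentLaws` — the crux C3′ BY NAME from GZK and ONE hypothesis: on every cell
  curve (with its simple-zero and main-conjecture binders) SOME consistent pair (leading-term law, comparison law) holds — the
  exact receptacle the typed statements T-23008-a/b (through stub O and §1) will fill. CONDITIONAL; closes nothing.
* §5 `leadingTermLaw_of_schneiderShape_of_mazurMainConjecture` — the L1-ADAPTER: a leading-term law of Schneider/BMS SHAPE
  (any generator `f_E` with `ord_T f_E = rank`, constants packed into `LOG`, `B`) + `MazurMainConjecture W p` + `ord_T L_p = 1` +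
  `rank = 1` ⟹ the §3 leading-term law with `A = ϖ · [T¹]L_p(f,α) · LOG`. With §3 this makes the eventual closure of stub L
  literally «L3 (§5 (T-23008-a)) (T-23008-b)».
* §6 `bsdp_of_normLeadingTerm_of_shaAnTransfer` — L3 in the NORM / `#Ш_an` currency of the cell's K2-Gv / K2-G′v (-es SketchG10 §14),
  slice-free: `‖A‖ = ‖#Ш[p^∞]·X‖` + `#Ш_an = q ∧ ‖A‖ = ‖q·X‖` + GZK ⟹ `BSDp W p`.
* §7 `bsdp_of_leadingTerm_of_normComparison` — mixed currency: ∃u-form leading term (from §5) + NORM-form comparison ⟹ `BSDp W p`.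
`--supports stmt-BirchSwinnertonDyer-23008 --as helper`; closes nothing.

References: [PerrinRiou1987] (comparison, p odd); [BalakrishnanMullerStein2015] Thm. 1.7 (leading term, p odd); [Miller2011LMS]
Def. 1.1 (`BSD(E,p)`); [GrossZagier1986], [Kolyvagin1990] (rank ≤ 1).
-/

set_option autoImplicit false
-- the route's Theorems namespace repeats a component by design (summit = sub-problem, D-0017).
set_option linter.dupNamespace false

noncomputable section

open scoped Classical

open WeierstrassCurve Literature.NumberTheory.EllipticCurves

namespace Summit.BirchSwinnertonDyer.BirchSwinnertonDyer.Theorems.AlignedTransportAtTwoLeadingTermAlgebra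

/-! ## §1 Generator plumbing in `Λ = ℤ_p⟦T⟧` -/

section Plumbing

variable {p : ℕ} [Fact p.Prime]

/-- **Two generators of one principal ideal of `Λ`, one vanishing at `T = 0`, have `T¹`-coefficients differing by a unit of
`ℤ_p`.** (`Λ` is a domain, so `(f) = (g)` makes `f = g·w` with `w ∈ Λˣ`; `[T¹](g·w) = [T⁰]g·[T¹]w + [T¹]g·[T⁰]w = [T¹]g · w(0)`
when `g(0) = 0`, and `w(0) ∈ ℤ_pˣ`.) Used with `g` the main-conjecture generator and `f = f_E` any characteristic generator.
[cite: Washington1997, §13.2 (Λ a UFD / units of Λ)] -/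
theorem exists_unit_coeff_one_eq_of_span_eq {f g : IwasawaAlgebra p}
    (h : Ideal.span ({f} : Set (IwasawaAlgebra p)) = Ideal.span {g}) (hg0 : PowerSeries.constantCoeff g = 0) :
    ∃ v : ℤ_[p]ˣ, PowerSeries.coeff 1 f = (v : ℤ_[p]) * PowerSeries.coeff 1 g := by
  have hassoc : Associated g f := Ideal.span_singleton_eq_span_singleton.mp h.symm
  obtain ⟨w, hw⟩ := hassoc
  have hwu : IsUnit (PowerSeries.constantCoeff (w : IwasawaAlgebra p)) :=
    PowerSeries.isUnit_constantCoeff _ w.isUnit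
  refine ⟨hwu.unit, ?_⟩
  rw [← hw, PowerSeries.coeff_mul, Finset.Nat.antidiagonal_succ, Finset.sum_cons, Finset.Nat.antidiagonal_zero,
    Finset.map_singleton, Finset.sum_singleton]
  simp only [Function.Embedding.coe_prodMap, Function.Embedding.coeFn_mk, Prod.map_apply, Nat.succ_eq_add_one,
    zero_add, Function.Embedding.refl_apply, PowerSeries.coeff_zero_eq_constantCoeff, hg0, zero_mul, IsUnit.unit_spec]
  ring

/-- **`[T¹]g = ϖ · [T¹]L` from `ι g = ϖ · L`** (`ι : ℤ_p⟦T⟧ → ℚ_p⟦T⟧` coefficientwise). [folklore] -/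
theorem coeff_one_eq_ratCast_mul_of_iwasawaToPowerSeries_eq {g : IwasawaAlgebra p} {ϖ : ℚ} {L : PowerSeries ℚ_[p]}
    (h : iwasawaToPowerSeries p g = PowerSeries.C (ϖ : ℚ_[p]) * L) :
    ((PowerSeries.coeff 1 g : ℤ_[p]) : ℚ_[p]) = (ϖ : ℚ_[p]) * PowerSeries.coeff 1 L := by
  have hc := congrArg (PowerSeries.coeff 1) h
  rw [PowerSeries.coeff_C_mul] at hc
  rw [← hc, iwasawaToPowerSeries, PowerSeries.coeff_map]
  rfl

/-- Combined: for ANY characteristic generator `f` of the ideal generated by the main-conjecture generator `g` (`ι g = ϖ · L`,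
`g(0) = 0`), `[T¹]f = v · ϖ · [T¹]L` in `ℚ_p` with `v ∈ ℤ_pˣ`. [folklore] -/
theorem exists_unit_coeff_one_eq_mul_of_span_eq_of_iwasawaToPowerSeries_eq {f g : IwasawaAlgebra p}
    (h : Ideal.span ({f} : Set (IwasawaAlgebra p)) = Ideal.span {g}) (hg0 : PowerSeries.constantCoeff g = 0)
    {ϖ : ℚ} {L : PowerSeries ℚ_[p]} (hι : iwasawaToPowerSeries p g = PowerSeries.C (ϖ : ℚ_[p]) * L) :
    ∃ v : ℤ_[p]ˣ, ((PowerSeries.coeff 1 f : ℤ_[p]) : ℚ_[p]) = ((v : ℤ_[p]) : ℚ_[p]) * ((ϖ : ℚ_[p]) * PowerSeries.coeff 1 L) := by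
  obtain ⟨v, hv⟩ := exists_unit_coeff_one_eq_of_span_eq h hg0
  refine ⟨v, ?_⟩
  rw [hv, PadicInt.coe_mul, coeff_one_eq_ratCast_mul_of_iwasawaToPowerSeries_eq hι]

end Plumbing

/-! ## §2 `p`-adic valuation bookkeeping -/

section Valuation

variable {p : ℕ} [Fact p.Prime]

/-- **`ord_p q = ord_p n`** when `(q : ℚ_p) = u · n` with `u ∈ ℤ_pˣ` and `n ≠ 0`. [folklore] -/
theorem padicValRat_eq_of_ratCast_eq_unit_mul_natCast {q : ℚ} {u : ℤ_[p]ˣ} {n : ℕ} (hn : n ≠ 0)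
    (h : (q : ℚ_[p]) = ((u : ℤ_[p]) : ℚ_[p]) * (n : ℚ_[p])) : padicValRat p q = padicValNat p n := by
  have hp1 : (1 : ℚ) < p := by exact_mod_cast (Fact.out : p.Prime).one_lt
  have hu : ‖((u : ℤ_[p]) : ℚ_[p])‖ = 1 := PadicInt.isUnit_iff.mp u.isUnit
  have hq0 : q ≠ 0 := by
    intro hq
    rw [hq, Rat.cast_zero, eq_comm, mul_eq_zero] at h
    rcases h with h | h
    · rw [← norm_eq_zero, hu] at h; exact one_ne_zero h
    · exact hn (by exact_mod_cast h)
  have hnorm : ‖(q : ℚ_[p])‖ = ‖((n : ℚ) : ℚ_[p])‖ := by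
    rw [h, norm_mul, hu, one_mul, Rat.cast_natCast]
  rw [Padic.eq_padicNorm, Padic.eq_padicNorm, padicNorm.eq_zpow_of_nonzero hq0,
    padicNorm.eq_zpow_of_nonzero (by exact_mod_cast hn : (n : ℚ) ≠ 0)] at hnorm
  have hinj := zpow_right_injective₀ (by positivity : (0 : ℚ) < p) hp1.ne' (by exact_mod_cast hnorm)
  have h2 := neg_injective hinj
  exact_mod_cast h2

end Valuation

/-! ## §3 L3 — `BSD(E,p)` from a leading-term law and a comparison law in the same currency -/

section Closure

variable (W : WeierstrassCurve ℚ) [W.IsElliptic] (p : ℕ) [Fact p.Prime]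

/-- **L3 (normalisation-free closure of stub L).** Let `E/ℚ` (globally minimal `W`) have `r_an ≤ 1`, and let `A, B ∈ ℚ_p`,
`B ≠ 0`, be ANY two `p`-adic quantities (intended: `A = ϖ·[T^r]L_p(f_E,α)·log_p(γ)^r`, `B = (1 − α⁻¹)²·Reg_p(Dh)`, in whatever
height currency). Assume (i) Gross–Zagier–Kolyvagin (`hGZK`, PRINT); (ii) a LEADING-TERM LAW
`A · #E(ℚ)_tors² = u · #Ш[p^∞] · B · ∏ c_v` with `u ∈ ℤ_pˣ` (Schneider/BMS shape, through the main conjecture); (iii) a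
COMPARISON LAW: a rational `q` with `q · B = A` in `ℚ_p` and `q · Ω_E · Reg_∞(E) = L^{(r)}(E,1)/r!` in `ℂ` (Perrin-Riou's
rank-one comparison shape). Then `BSDp W p`: `rank = r_an` and `Ш` finite by GZK, `#Ш_an = q · tors² / ∏ c_v ∈ ℚ`, and
`ord_p #Ш_an = ord_p #Ш[p^∞]` because `tors²` and `∏ c_v` CANCEL between (ii) and (iii). Nothing about `p = 2` is special here;
the `p = 2` content of the crux is entirely in the truth of (ii) and (iii) at `2`. [cite: PerrinRiou1987, Thm. (rank-one comparison, p odd)]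
[cite: BalakrishnanMullerStein2015, Thm. 1.7] [cite: Miller2011LMS, Def. 1.1] -/
theorem bsdp_of_leadingTerm_of_comparison (hGZK : rank_eq_analyticRank_of_analyticRank_le_one)
    (hr : W.analyticRank ≤ 1) {A B : ℚ_[p]} (hB : B ≠ 0)
    (hLT : ∃ u : ℤ_[p]ˣ, A * (W.torsionOrder : ℚ_[p]) ^ 2 =
      ((u : ℤ_[p]) : ℚ_[p]) * (Nat.card (AddCommGroup.primaryComponent W.sha p) : ℚ_[p]) * B * (W.tamagawaProduct : ℚ_[p]))
    (hCMP : ∃ q : ℚ, (q : ℚ_[p]) * B = A ∧ (q : ℂ) * ((W.realPeriodRat : ℂ) * (W.regulator : ℂ)) = W.leadingLCoeff) :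
    BSDp W p := by
  obtain ⟨hrank, hfin⟩ := hGZK W hr
  haveI : Finite W.sha := hfin
  haveI hfinp : Finite (AddCommGroup.primaryComponent W.sha p) := inferInstance
  obtain ⟨u, hu⟩ := hLT
  obtain ⟨q, hqB, hqC⟩ := hCMP
  -- positivity of the archimedean and arithmetic factors
  have hΩ : (W.realPeriodRat : ℂ) ≠ 0 := by exact_mod_cast W.realPeriodRat_pos_holds.ne'
  have hR : (W.regulator : ℂ) ≠ 0 := by exact_mod_cast (W.regulator_pos').ne'
  have hc0 : 0 < W.tamagawaProduct := W.tamagawaProduct_pos_holds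
  have hcC : (W.tamagawaProduct : ℂ) ≠ 0 := by exact_mod_cast hc0.ne'
  have hcP : (W.tamagawaProduct : ℚ_[p]) ≠ 0 := by exact_mod_cast hc0.ne'
  have hn0 : Nat.card (AddCommGroup.primaryComponent W.sha p) ≠ 0 := Nat.card_pos.ne'
  refine ⟨hrank, hfinp, q * (W.torsionOrder : ℚ) ^ 2 / W.tamagawaProduct, ?_, ?_⟩
  · -- `#Ш_an = q · tors² / ∏ c_v`
    rw [shaAn_def, ← hqC]
    push_cast
    field_simp
  · -- `ord_p (q · tors² / ∏ c_v) = ord_p #Ш[p^∞]`: cancel `B`, `tors²`, `∏ c_v`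
    rw [← hqB] at hu
    have hkey : ((q * (W.torsionOrder : ℚ) ^ 2 / W.tamagawaProduct : ℚ) : ℚ_[p]) =
        ((u : ℤ_[p]) : ℚ_[p]) * (Nat.card (AddCommGroup.primaryComponent W.sha p) : ℚ_[p]) := by
      push_cast
      rw [div_eq_iff hcP]
      have h' : ((q : ℚ_[p]) * (W.torsionOrder : ℚ_[p]) ^ 2) * B =
          (((u : ℤ_[p]) : ℚ_[p]) * (Nat.card (AddCommGroup.primaryComponent W.sha p) : ℚ_[p]) *
            (W.tamagawaProduct : ℚ_[p])) * B := by
        linear_combination hu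
      exact mul_right_cancel₀ hB h'
    exact padicValRat_eq_of_ratCast_eq_unit_mul_natCast hn0 hkey

end Closure

/-! ## §4 The crux C3′ BY NAME from GZK and a consistent pair of laws on the cell -/

/-- **C3′ from Gross–Zagier–Kolyvagin and a CONSISTENT PAIR OF LAWS on the cell (CONDITIONAL; closes nothing).** If for every
cell curve `W` (non-CM, good ordinary at `2`, no rational `2`-torsion, `Δ ∉ ℚ²`, `r_an = 1`, simple zero of `L₂(f_E)` at `T = 0`,
Mazur's `2`-adic main conjecture) there are `2`-adic quantities `A`, `B ≠ 0` satisfying a leading-term law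
`A · tors² = u · #Ш[2^∞] · B · ∏ c_v` (`u ∈ ℤ₂ˣ`) and a comparison law `q · B = A`, `q · Ω_E · Reg_∞ = L′(E,1)` (`q ∈ ℚ`) — the
receptacle that the typed `p = 2` Schneider/BMS leading term (through stub O's simple zero and §1's generator plumbing) and the
typed `p = 2` Perrin-Riou comparison are to fill, IN THE SAME CURRENCY — then `BSDOfMainConjectureRankOneAtTwo` (by §3 and the
PRINT fact `rank_eq_analyticRank_of_analyticRank_le_one`). BSD is not proved; the crux stays open (the hypothesis is open at `2`).
[cite: PerrinRiou1987, Thm. (rank-one comparison, p odd)] [cite: BalakrishnanMullerStein2015, Thm. 1.7] [cite: Miller2011LMS, Def. 1.1] -/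
theorem bsdOfMainConjectureRankOneAtTwo_of_consistentLaws (hGZK : rank_eq_analyticRank_of_analyticRank_le_one)
    (hLaws : ∀ (W : WeierstrassCurve ℚ) [W.IsElliptic] [W.IsGloballyMinimal],
      ¬ W.HasCM → IsOrdinaryAt W 2 → (∀ x : ℚ, ¬ Greenberg1999.HasRationalTwoTorsionX W x) → ¬ IsSquare W.Δ →
      W.analyticRank = 1 →
      (∀ [NeZero (W.conductorNorm ℤ)] (f : CuspForm (CongruenceSubgroup.Gamma0 (W.conductorNorm ℤ)) 2),
          ModularForms.IsNewformOf W f → (padicLFunction f (unitRoot W 2 : ℚ_[2])).order = 1) →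
      Summit.BirchSwinnertonDyer.BirchSwinnertonDyer.Theorems.Rank1ResidualX1Defs.MazurMainConjecture W 2 →
      ∃ A B : ℚ_[2], B ≠ 0 ∧
        (∃ u : ℤ_[2]ˣ, A * (W.torsionOrder : ℚ_[2]) ^ 2 =
          ((u : ℤ_[2]) : ℚ_[2]) * (Nat.card (AddCommGroup.primaryComponent W.sha 2) : ℚ_[2]) * B *
            (W.tamagawaProduct : ℚ_[2])) ∧
        (∃ q : ℚ, (q : ℚ_[2]) * B = A ∧ (q : ℂ) * ((W.realPeriodRat : ℂ) * (W.regulator : ℂ)) = W.leadingLCoeff)) :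
    Summit.BirchSwinnertonDyer.BirchSwinnertonDyer.Theses.AlignedTransportAtTwo.BSDOfMainConjectureRankOneAtTwo := by
  intro W _ _ hcm hord ht hsq hr hL hMC
  obtain ⟨A, B, hB, hLT, hCMP⟩ := hLaws W hcm hord ht hsq hr hL hMC
  exact bsdp_of_leadingTerm_of_comparison W 2 hGZK (by omega) hB hLT hCMP

/-! ## §5 The L1-adapter: a Schneider-SHAPED leading-term law, read through Mazur's main conjecture, is the
leading-term law of §3 with `A = ϖ · [T¹]L_p(f_E, α) · LOG` (appended by the lead, same session) -/

section Adapter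

open CongruenceSubgroup Literature.NumberTheory.EllipticCurves.ModularForms
  Summit.BirchSwinnertonDyer.BirchSwinnertonDyer.Theorems.Rank1ResidualX1Defs
  Summit.BirchSwinnertonDyer.BirchSwinnertonDyer.Theorems.AlignedTransportAtTwoOrderTransfer

variable (W : WeierstrassCurve ℚ) [W.IsElliptic] [W.IsGloballyMinimal] (p : ℕ) [Fact p.Prime]

/-- **L1-adapter (any prime, normalisation-free).** Fix a conductor-level newform `f` of `W`, a rational `ϖ` with
`ϖ · Ω_E = Ω⁺_f`, and two `p`-adic parameters `LOG` (intended `log_p(γ_cyc)`) and `B` (intended `ε_p · Reg_p(Dh)`). Suppose a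
leading-term law OF SCHNEIDER/BMS SHAPE holds at `(W, p)` — for every cyclotomic datum `(κ, γ)`, every dual datum `D` which is
torsion, and EVERY characteristic generator `f_E` with `ord_T f_E = rank E(ℚ)`:
`[T¹]f_E · LOG · tors² = u · #Ш[p^∞] · B · ∏ c_v`, `u ∈ ℤ_pˣ` (this is clause (3) of `Schneider1985_order_charGenerator` in rank one,
with its `p`-adic constants packed into `LOG`, `B`). If `rank E(ℚ) = 1`, `ord_T L_p(f, α) = 1` and `MazurMainConjecture W p`, then the
§3 leading-term law holds with `A = ϖ · [T¹]L_p(f, α) · LOG`: the main conjecture supplies, at the (existing, THEOREM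
`exists_isCyclotomic_isTopGenerator_isCyclotomicVariable_holds`) cyclotomic datum and the dual datum
`nonempty_selmerDualData_holds`, a generator `g` with `ι g = ϖ · L_p(f, α)`, hence `ord_T g = 1 = rank` (ι preserves the order,
`ϖ ≠ 0`) and `[T¹]g = ϖ · [T¹]L_p(f, α)` (§1). [cite: BalakrishnanMullerStein2015, Thm. 1.7 (shape of clause 3)]
[cite: MazurTateTeitelbaum1986Invent, §I.12] -/
theorem leadingTermLaw_of_schneiderShape_of_mazurMainConjecture [NeZero (W.conductorNorm ℤ)]
    {f : CuspForm (Gamma0 (W.conductorNorm ℤ)) 2} (hf : IsNewformOf W f)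
    {ϖ : ℚ} (hϖ : (ϖ : ℝ) * W.realPeriodRat = plusPeriod f) {LOG B : ℚ_[p]}
    (hS : ∀ (κ : ZpExtension ℚ p) (γ : Field.absoluteGaloisGroup ℚ),
      κ.IsCyclotomic → κ.IsTopGenerator γ → IsCyclotomicVariable p γ →
      ∀ (D : W.SelmerDualData κ γ) [Module.Finite (IwasawaAlgebra p) D.X], D.IsTorsion →
      ∀ fE : IwasawaAlgebra p, D.charIdeal = Ideal.span {fE} → fE.order = (W.mordellWeilRank : ℕ∞) →
        ∃ u : ℤ_[p]ˣ, ((PowerSeries.coeff 1 fE : ℤ_[p]) : ℚ_[p]) * LOG * (W.torsionOrder : ℚ_[p]) ^ 2 =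
          ((u : ℤ_[p]) : ℚ_[p]) * (Nat.card (AddCommGroup.primaryComponent W.sha p) : ℚ_[p]) * B *
            (W.tamagawaProduct : ℚ_[p]))
    (hrank : W.mordellWeilRank = 1)
    (hL : (padicLFunction f (unitRoot W p : ℚ_[p])).order = 1)
    (hMC : MazurMainConjecture W p) :
    ∃ u : ℤ_[p]ˣ, ((ϖ : ℚ_[p]) * PowerSeries.coeff 1 (padicLFunction f (unitRoot W p : ℚ_[p])) * LOG) *
        (W.torsionOrder : ℚ_[p]) ^ 2 =
      ((u : ℤ_[p]) : ℚ_[p]) * (Nat.card (AddCommGroup.primaryComponent W.sha p) : ℚ_[p]) * B *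
        (W.tamagawaProduct : ℚ_[p]) := by
  -- the cyclotomic setting and a dual datum
  obtain ⟨κ, hκ, γ, hγ, hγ'⟩ := exists_isCyclotomic_isTopGenerator_isCyclotomicVariable_holds p
  obtain ⟨D⟩ := W.nonempty_selmerDualData_holds κ γ hγ
  haveI : Module.Finite (IwasawaAlgebra p) D.X := D.module_finite_holds hγ
  -- the main conjecture at this datum
  obtain ⟨hX, g, hchar, hι⟩ := hMC κ γ hκ hγ hγ' f hf ϖ hϖ D
  -- `ϖ ≠ 0`, so `ord_T g = ord_T L_p = 1 = rank`
  have hϖ0 : ϖ ≠ 0 := by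
    rintro rfl
    have hper : 0 < plusPeriod f := IsNewform0.plusPeriod_pos_holds hf.1 hf.coeffField_eq_bot
    rw [← hϖ, Rat.cast_zero, zero_mul] at hper
    exact lt_irrefl _ hper
  have hc : (ϖ : ℚ_[p]) ≠ 0 := by exact_mod_cast hϖ0
  have hord : g.order = (W.mordellWeilRank : ℕ∞) := by
    rw [← order_eq_order_of_iwasawaToPowerSeries_eq_C_mul p hc hι, hL, hrank]
    rfl
  -- the Schneider-shaped law at `f_E := g`, and `[T¹]g = ϖ · [T¹]L_p`
  obtain ⟨u, hu⟩ := hS κ γ hκ hγ hγ' D hX g hchar hord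
  refine ⟨u, ?_⟩
  rw [← hu, coeff_one_eq_ratCast_mul_of_iwasawaToPowerSeries_eq hι]

end Adapter

/-! ## §6 The NORM-form closure (the currency of the cell's K2-Gv / K2-G′v, -es SketchG10 §14): slice-free Glue14 -/

section NormForm

variable {p : ℕ} [Fact p.Prime]

/-- **`ord_p q = ord_p n`** from `‖(q : ℚ_p)‖ = ‖(n : ℚ_p)‖`, `n ≠ 0`. [folklore] -/
theorem padicValRat_eq_padicValNat_of_norm_eq {q : ℚ} {n : ℕ} (hn : n ≠ 0)
    (h : ‖(q : ℚ_[p])‖ = ‖(n : ℚ_[p])‖) : padicValRat p q = padicValNat p n := by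
  have hp1 : (1 : ℚ) < p := by exact_mod_cast (Fact.out : p.Prime).one_lt
  have hq0 : q ≠ 0 := by
    intro hq
    rw [hq, Rat.cast_zero, norm_zero, eq_comm, norm_eq_zero] at h
    exact hn (by exact_mod_cast h)
  rw [← Rat.cast_natCast, Padic.eq_padicNorm, Padic.eq_padicNorm, padicNorm.eq_zpow_of_nonzero hq0,
    padicNorm.eq_zpow_of_nonzero (by exact_mod_cast hn : (n : ℚ) ≠ 0)] at h
  have hinj := zpow_right_injective₀ (by positivity : (0 : ℚ) < p) hp1.ne' (by exact_mod_cast h)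
  have h2 := neg_injective hinj
  exact_mod_cast h2

variable (W : WeierstrassCurve ℚ) [W.IsElliptic] (p)

/-- **L3 in NORM currency (slice-free Glue14).** For `E/ℚ` with `r_an ≤ 1` and ANY `p`-adic quantities `A` and `X ≠ 0` (intended
`A = ϖ·[T¹]L_p(f,α)·log_p γ·tors²`, `X = (1 − α⁻¹)²·Reg_p(Dh)·∏ c_v`): Gross–Zagier–Kolyvagin + a leading-term law in norm form
`‖A‖ = ‖#Ш[p^∞] · X‖` (the cell's K2-Gv shape) + a transfer law in `#Ш_an`-form `#Ш_an = q ∈ ℚ ∧ ‖A‖ = ‖q · X‖` (the cell's K2-G′v shape)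
⟹ `BSDp W p` (`‖#Ш[p^∞]·X‖ = ‖q·X‖`, cancel `‖X‖ ≠ 0`, read valuations). No slice hypothesis (no odd-Tamagawa / big-image binder) is
needed: whatever sits in `X` cancels. [cite: Miller2011LMS, Def. 1.1] [cite: BalakrishnanMullerStein2015, Conj. 1.4 / Thm. 1.7 (shape)] -/
theorem bsdp_of_normLeadingTerm_of_shaAnTransfer (hGZK : rank_eq_analyticRank_of_analyticRank_le_one)
    (hr : W.analyticRank ≤ 1) {A X : ℚ_[p]} (hX : X ≠ 0)
    (hLT : ‖A‖ = ‖(Nat.card (AddCommGroup.primaryComponent W.sha p) : ℚ_[p]) * X‖)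
    (hCMP : ∃ q : ℚ, shaAn W = (q : ℂ) ∧ ‖A‖ = ‖(q : ℚ_[p]) * X‖) :
    BSDp W p := by
  obtain ⟨hrank, hfin⟩ := hGZK W hr
  haveI : Finite W.sha := hfin
  haveI hfinp : Finite (AddCommGroup.primaryComponent W.sha p) := inferInstance
  obtain ⟨q, hq, hqn⟩ := hCMP
  have hn0 : Nat.card (AddCommGroup.primaryComponent W.sha p) ≠ 0 := Nat.card_pos.ne'
  refine ⟨hrank, hfinp, q, hq, ?_⟩
  have h : ‖(q : ℚ_[p])‖ = ‖(Nat.card (AddCommGroup.primaryComponent W.sha p) : ℚ_[p])‖ := by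
    have h1 := hLT.symm.trans hqn
    rw [norm_mul, norm_mul] at h1
    exact (mul_right_cancel₀ (norm_ne_zero_iff.mpr hX) h1).symm
  exact padicValRat_eq_padicValNat_of_norm_eq hn0 h

end NormForm

/-! ## §7 Mixed currency: ∃u-form leading-term law (Schneider shape through MC, §5) + NORM-form comparison law -/

section Mixed

variable (W : WeierstrassCurve ℚ) [W.IsElliptic] (p : ℕ) [Fact p.Prime]

/-- **L3, mixed currency.** GZK + a leading-term law in `∃u`-form `A·tors² = u·#Ш[p^∞]·B·Tam` (what §5's adapter delivers from a
Schneider-shaped statement through the main conjecture) + a comparison law in NORM form `‖q·B‖ = ‖A‖ ∧ q·Ω·Reg_∞ = L^{(r)}(E,1)/r!`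
(the weaker, valuation-only reading of Perrin-Riou's comparison — all that `BSD(E,p)` consumes) ⟹ `BSDp W p`, witness `q·tors²/Tam`.
[cite: PerrinRiou1987] [cite: BalakrishnanMullerStein2015, Thm. 1.7] [cite: Miller2011LMS, Def. 1.1] -/
theorem bsdp_of_leadingTerm_of_normComparison (hGZK : rank_eq_analyticRank_of_analyticRank_le_one)
    (hr : W.analyticRank ≤ 1) {A B : ℚ_[p]} (hB : B ≠ 0)
    (hLT : ∃ u : ℤ_[p]ˣ, A * (W.torsionOrder : ℚ_[p]) ^ 2 =
      ((u : ℤ_[p]) : ℚ_[p]) * (Nat.card (AddCommGroup.primaryComponent W.sha p) : ℚ_[p]) * B * (W.tamagawaProduct : ℚ_[p]))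
    (hCMP : ∃ q : ℚ, ‖(q : ℚ_[p]) * B‖ = ‖A‖ ∧ (q : ℂ) * ((W.realPeriodRat : ℂ) * (W.regulator : ℂ)) = W.leadingLCoeff) :
    BSDp W p := by
  obtain ⟨u, hu⟩ := hLT
  obtain ⟨q, hqB, hqC⟩ := hCMP
  have hΩ : (W.realPeriodRat : ℂ) ≠ 0 := by exact_mod_cast W.realPeriodRat_pos_holds.ne'
  have hR : (W.regulator : ℂ) ≠ 0 := by exact_mod_cast (W.regulator_pos').ne'
  have hc0 : 0 < W.tamagawaProduct := W.tamagawaProduct_pos_holds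
  have hcC : (W.tamagawaProduct : ℂ) ≠ 0 := by exact_mod_cast hc0.ne'
  have hcP : (W.tamagawaProduct : ℚ_[p]) ≠ 0 := by exact_mod_cast hc0.ne'
  have huN : ‖((u : ℤ_[p]) : ℚ_[p])‖ = 1 := PadicInt.isUnit_iff.mp u.isUnit
  refine bsdp_of_normLeadingTerm_of_shaAnTransfer p W hGZK hr (mul_ne_zero hB hcP)
    (A := A * (W.torsionOrder : ℚ_[p]) ^ 2) ?_ ⟨q * (W.torsionOrder : ℚ) ^ 2 / W.tamagawaProduct, ?_, ?_⟩
  · -- `‖A·tors²‖ = ‖#Ш · (B·Tam)‖`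
    rw [hu, norm_mul, norm_mul, norm_mul, huN, one_mul, ← norm_mul, ← norm_mul, mul_assoc]
  · -- `#Ш_an = q·tors²/Tam`
    rw [shaAn_def, ← hqC]
    push_cast
    field_simp
  · -- `‖A·tors²‖ = ‖(q·tors²/Tam) · (B·Tam)‖`
    have h1 : ((q * (W.torsionOrder : ℚ) ^ 2 / W.tamagawaProduct : ℚ) : ℚ_[p]) * (B * (W.tamagawaProduct : ℚ_[p])) =
        ((q : ℚ_[p]) * B) * (W.torsionOrder : ℚ_[p]) ^ 2 := by
      push_cast
      field_simp
    rw [h1, norm_mul, norm_mul, hqB]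

end Mixed

end Summit.BirchSwinnertonDyer.BirchSwinnertonDyer.Theorems.AlignedTransportAtTwoLeadingTermAlgebra

end
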